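import Summits.KontsevichZagierPeriods.KontsevichZagierPeriods.Theorems.KzOnePeriodsE1XiLoops

/-!
# KZ 1-periods (kz1p): pinning the winding number of a loop on `𝔾ₘ` from a sign pattern

Helper file of the `kz1p` support package (explicit unit `b2b-kz1p`, helper lane; it supports the audited
statement item of `KzOnePeriods` without closing it).  Shape (U) "unit at infinity" of the genus-2 derivations
(`KzOnePeriodsG2SUnit.lean`) transports a third-kind period `∫_γ p(x) dx/(2y)`, residue divisor at `∞±`, to
the logarithm symbol `(𝔾ₘ, v du, u∘γ)` of a Pell unit `u = P + Q·y` of `ℚ̄[C]`.  Over a CLOSED loop that symbol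
is `(𝔾ₘ, v du, Λ_{p,w})` for the winding number `w ∈ ℤ` of `u∘γ` (`single_loop_eq_single_stdLoop`), and for an
EXACT relation `w` must be pinned.  This file pins it in the two situations met on kz1p's ovals, from facts the
generated per-case files certify by sign computations:

* `mem_Ioo_of_sin_sub_pos`, `mem_Icc_of_sin_sub_pos` — a continuous real function `ϑ` on `[a, b]` with
  `ϑ(a) = α` and `sin(ϑ(s) − α) > 0` for `a < s < b` stays in the cell `[α, α + π]` (intermediate value theorem);
* `log_one_eq_log_zero_add_two_pi_I` — a continuous logarithm `L` of `λ = exp ∘ L` on `[0, 1]` with `λ(0) = λ(1) > 0`,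
  `λ(½) < 0` (both real), `Im λ > 0` on `(0, ½)` and `Im λ < 0` on `(½, 1)` has `L(1) = L(0) + 2πi`: WINDING NUMBER ONE;
* `span_logSym_halves` — for a closed `C¹` path `γ` on `𝔾ₘ` whose first coordinate has that sign pattern,
  `(𝔾ₘ, v du, γ) − (𝔾ₘ, v du, Λ_{1,1}) ∈ ⟨(R1)–(R5)⟩_ℚ̄` with the standard unit loop `Λ_{1,1}(t) = (e^{2πit}, e^{−2πit})`
  (book §3.3.1: the homotopy to the standard loop `Λ_{γ(0)₀,1}`; §13.1 (B): the base change `u ↦ u/γ(0)₀`), hence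
  `∫_γ v du = 2πi` (`period_logSym_halves`; book §10.1: `2πi` is the period of `𝔾ₘ`);
* `span_logSym_realPos_closed` — a closed path on `𝔾ₘ` with real positive first coordinate is a relation,
  `(𝔾ₘ, v du, γ) ∼ ℓ(log 1) ∼ 0` (winding number zero), `∫_γ v du = 0` (`period_logSym_realPos_closed`).

[cite: HuberWustholz2022, §3.3.1 (pp. 42–43), §10.1 (p. 96), §13.1 (B) (p. 120), Thm 13.3 (2) (p. 121)]

No new axioms; no statements of the programme are cited.
-/

noncomputable section

open scoped BigOperators
open scoped Real
open MvPolynomial Set Complex Filter Topology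
open Literature.NumberTheory.Transcendental Literature.NumberTheory.Transcendental.CurvePeriods

namespace Summit.KontsevichZagierPeriods.KzOnePeriods.XiDerivation

local notation3 "InSpanRel " c:arg => ∃ (k : ℕ) (ρ : Fin k → (PeriodSymbol →₀ ℂ))
  (a : Fin k → ℂ), (∀ l, IsElementaryRelation (ρ l)) ∧ (∀ l, IsAlgebraic ℚ (a l)) ∧
    c = ∑ l, a l • ρ l

/-- The multiplicative group `𝔾ₘ = {uv = 1} ⊂ 𝔸²`. -/
local notation3 (prettyPrint := false) "𝔾m" => (⟨2, 1, ![X 0 * X 1 - 1]⟩ : CurveData)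

/-- The logarithm symbol `(𝔾ₘ, v du, E)` over a path `E` on `𝔾ₘ`. -/
local notation3 "logSym " E:arg => (⟨⟨2, 1, ![X 0 * X 1 - 1]⟩, isSmoothAffineCurve_mulGroup,
  ![X 1, 0], hasAlgCoeffs_ydx, E⟩ : PeriodSymbol)

/-! ### A continuous argument with a sign condition stays in one cell -/

/-- **Cell lemma (interior).**  If `ϑ` is continuous on `[a, b]`, `ϑ(a) = α` and `sin(ϑ(s) − α) > 0` for all
`a < s < b`, then `α < ϑ(s) < α + π` for all `a < s < b` (else, by the intermediate value theorem, `ϑ − α` would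
take one of the values `π`, `−π/2` — where the sine is `≤ 0` — or lie in `(−π, 0]` at an interior point). -/
theorem mem_Ioo_of_sin_sub_pos {ϑ : ℝ → ℝ} {a b α : ℝ} (hϑ : ContinuousOn ϑ (Icc a b))
    (ha : ϑ a = α) (hpos : ∀ s ∈ Ioo a b, 0 < Real.sin (ϑ s - α)) :
    ∀ s ∈ Ioo a b, ϑ s ∈ Ioo α (α + Real.pi) := by
  intro s hs
  have has : a ≤ s := hs.1.le
  have hϑs : ContinuousOn ϑ (Icc a s) := hϑ.mono (Icc_subset_Icc_right hs.2.le)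
  have hπ := Real.pi_pos
  constructor
  · by_contra hlt
    push Not at hlt
    by_cases hpi : -Real.pi < ϑ s - α
    · have h1 := Real.sin_nonpos_of_nonpos_of_neg_pi_le (by linarith : ϑ s - α ≤ 0) hpi.le
      linarith [hpos s hs]
    · push Not at hpi
      have hmem : α - Real.pi / 2 ∈ Icc (ϑ s) (ϑ a) := by
        rw [ha]; constructor <;> linarith
      obtain ⟨r, hr, hϑr⟩ := intermediate_value_Icc' has hϑs hmem
      have hra : r ≠ a := by
        rintro rfl
        rw [ha] at hϑr
        linarith
      have hrI : r ∈ Ioo a b := ⟨lt_of_le_of_ne hr.1 (Ne.symm hra), lt_of_le_of_lt hr.2 hs.2⟩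
      have h1 := hpos r hrI
      rw [hϑr, show α - Real.pi / 2 - α = -(Real.pi / 2) by ring, Real.sin_neg,
        Real.sin_pi_div_two] at h1
      linarith
  · by_contra hle
    push Not at hle
    have hmem : α + Real.pi ∈ Icc (ϑ a) (ϑ s) := by
      rw [ha]; constructor <;> linarith
    obtain ⟨r, hr, hϑr⟩ := intermediate_value_Icc has hϑs hmem
    have hra : r ≠ a := by
      rintro rfl
      rw [ha] at hϑr
      linarith
    have hrI : r ∈ Ioo a b := ⟨lt_of_le_of_ne hr.1 (Ne.symm hra), lt_of_le_of_lt hr.2 hs.2⟩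
    have h1 := hpos r hrI
    rw [hϑr, show α + Real.pi - α = Real.pi by ring, Real.sin_pi] at h1
    exact lt_irrefl _ h1

/-- **Cell lemma (end point).**  Under the same hypotheses (`a < b`), `α ≤ ϑ(b) ≤ α + π`. -/
theorem mem_Icc_of_sin_sub_pos {ϑ : ℝ → ℝ} {a b α : ℝ} (hab : a < b)
    (hϑ : ContinuousOn ϑ (Icc a b)) (ha : ϑ a = α) (hpos : ∀ s ∈ Ioo a b, 0 < Real.sin (ϑ s - α)) :
    ϑ b ∈ Icc α (α + Real.pi) := by
  have key := mem_Ioo_of_sin_sub_pos hϑ ha hpos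
  have hmI : (a + b) / 2 ∈ Ioo a b := ⟨by linarith, by linarith⟩
  have hϑm := key _ hmI
  have hmb : (a + b) / 2 ≤ b := hmI.2.le
  have hϑmb : ContinuousOn ϑ (Icc ((a + b) / 2) b) := hϑ.mono (Icc_subset_Icc_left hmI.1.le)
  constructor
  · by_contra hlt
    push Not at hlt
    have hmem : α ∈ Icc (ϑ b) (ϑ ((a + b) / 2)) := ⟨hlt.le, hϑm.1.le⟩
    obtain ⟨r, hr, hϑr⟩ := intermediate_value_Icc' hmb hϑmb hmem
    have hrb : r ≠ b := by
      rintro rfl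
      linarith
    have hrI : r ∈ Ioo a b := ⟨lt_of_lt_of_le hmI.1 hr.1, lt_of_le_of_ne hr.2 hrb⟩
    have h1 := hpos r hrI
    rw [hϑr, sub_self, Real.sin_zero] at h1
    exact lt_irrefl _ h1
  · by_contra hlt
    push Not at hlt
    have hmem : α + Real.pi ∈ Icc (ϑ ((a + b) / 2)) (ϑ b) := ⟨hϑm.2.le, hlt.le⟩
    obtain ⟨r, hr, hϑr⟩ := intermediate_value_Icc hmb hϑmb hmem
    have hrb : r ≠ b := by
      rintro rfl
      linarith
    have hrI : r ∈ Ioo a b := ⟨lt_of_lt_of_le hmI.1 hr.1, lt_of_le_of_ne hr.2 hrb⟩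
    have h1 := hpos r hrI
    rw [hϑr, show α + Real.pi - α = Real.pi by ring, Real.sin_pi] at h1
    exact lt_irrefl _ h1

/-! ### Winding number one from the sign pattern of the imaginary part -/

set_option linter.unusedSimpArgs false in
/-- **Winding number one.**  Let `L` be a continuous logarithm of `λ` on `[0, 1]` (`exp (L t) = λ t`), with
`λ(0) = r₀ > 0`, `λ(½) = −r₁ < 0` (real), `λ(1) = λ(0)`, `Im λ > 0` on `(0, ½)` and `Im λ < 0` on `(½, 1)`.  Then
`L(1) = L(0) + 2πi`.  Proof: `Im L` is a continuous argument; by the cell lemma it moves from `2πn₀` at `t = 0`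
into `[2πn₀, 2πn₀ + π]` at `t = ½`, where it is `≡ π (mod 2π)`, hence equals `2πn₀ + π`; then into
`[2πn₀ + π, 2πn₀ + 2π]` at `t = 1`, where it is `≡ 0 (mod 2π)`, hence equals `2πn₀ + 2π`. -/
theorem log_one_eq_log_zero_add_two_pi_I {L lam : ℝ → ℂ} (hL : ContinuousOn L (Icc 0 1))
    (hexp : ∀ t ∈ Icc (0 : ℝ) 1, exp (L t) = lam t) {r₀ r₁ : ℝ} (hr₀ : 0 < r₀) (hr₁ : 0 < r₁)
    (h0 : lam 0 = (r₀ : ℂ)) (hh : lam (1 / 2) = -(r₁ : ℂ)) (h1 : lam 1 = lam 0)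
    (hup : ∀ t ∈ Ioo (0 : ℝ) (1 / 2), 0 < (lam t).im)
    (hdn : ∀ t ∈ Ioo (1 / 2 : ℝ) 1, (lam t).im < 0) :
    L 1 = L 0 + 2 * Real.pi * I := by
  have hI0 : (0 : ℝ) ∈ Icc (0 : ℝ) 1 := ⟨le_rfl, zero_le_one⟩
  have hIh : (1 / 2 : ℝ) ∈ Icc (0 : ℝ) 1 := ⟨by norm_num, by norm_num⟩
  have hI1 : (1 : ℝ) ∈ Icc (0 : ℝ) 1 := ⟨zero_le_one, le_rfl⟩
  have hπ := Real.pi_pos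
  -- the anchor values of `L` modulo `2πi ℤ`
  obtain ⟨n₀, hn₀⟩ : ∃ n : ℤ, L 0 = ((Real.log r₀ : ℝ) : ℂ) + n * (2 * Real.pi * I) := by
    refine Complex.exp_eq_exp_iff_exists_int.1 ?_
    rw [hexp 0 hI0, h0, ← Complex.ofReal_exp, Real.exp_log hr₀]
  obtain ⟨n₁, hn₁⟩ : ∃ n : ℤ, L (1 / 2) =
      (((Real.log r₁ : ℝ) : ℂ) + Real.pi * I) + n * (2 * Real.pi * I) := by
    refine Complex.exp_eq_exp_iff_exists_int.1 ?_
    rw [hexp _ hIh, hh, Complex.exp_add, Complex.exp_pi_mul_I, ← Complex.ofReal_exp,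
      Real.exp_log hr₁]
    ring
  obtain ⟨m, hm⟩ : ∃ n : ℤ, L 1 = L 0 + n * (2 * Real.pi * I) := by
    refine Complex.exp_eq_exp_iff_exists_int.1 ?_
    rw [hexp 1 hI1, hexp 0 hI0, h1]
  have him0 : (L 0).im = n₀ * (2 * Real.pi) := by
    have e := congrArg Complex.im hn₀
    simp only [Complex.add_im, Complex.ofReal_im, Complex.mul_im, Complex.intCast_re,
      Complex.intCast_im, Complex.mul_re, Complex.re_ofNat, Complex.ofReal_re, Complex.I_re,
      Complex.im_ofNat, Complex.ofReal_im, Complex.I_im, mul_zero, sub_zero, zero_mul, mul_one,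
      add_zero, zero_add] at e
    rw [e]
  have himh : (L (1 / 2)).im = Real.pi + n₁ * (2 * Real.pi) := by
    have e := congrArg Complex.im hn₁
    simp only [Complex.add_im, Complex.ofReal_im, Complex.mul_im, Complex.intCast_re,
      Complex.intCast_im, Complex.mul_re, Complex.re_ofNat, Complex.ofReal_re, Complex.I_re,
      Complex.im_ofNat, Complex.ofReal_im, Complex.I_im, mul_zero, sub_zero, zero_mul, mul_one,
      add_zero, zero_add] at e
    rw [e]
  have him1 : (L 1).im = (L 0).im + m * (2 * Real.pi) := by
    have e := congrArg Complex.im hm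
    simp only [Complex.add_im, Complex.ofReal_im, Complex.mul_im, Complex.intCast_re,
      Complex.intCast_im, Complex.mul_re, Complex.re_ofNat, Complex.ofReal_re, Complex.I_re,
      Complex.im_ofNat, Complex.ofReal_im, Complex.I_im, mul_zero, sub_zero, zero_mul, mul_one,
      add_zero, zero_add] at e
    rw [e]
  -- the sign of `sin (Im L)` is the sign of `Im λ`
  have hsin : ∀ t ∈ Icc (0 : ℝ) 1, (lam t).im = Real.exp (L t).re * Real.sin (L t).im :=
    fun t ht => by rw [← hexp t ht, Complex.exp_im]
  have hup' : ∀ t ∈ Ioo (0 : ℝ) (1 / 2), 0 < Real.sin (L t).im := fun t ht => by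
    have h := hup t ht
    rw [hsin t ⟨ht.1.le, by linarith [ht.2]⟩] at h
    by_contra hc
    push Not at hc
    nlinarith [Real.exp_pos (L t).re]
  have hdn' : ∀ t ∈ Ioo (1 / 2 : ℝ) 1, Real.sin (L t).im < 0 := fun t ht => by
    have h := hdn t ht
    rw [hsin t ⟨by linarith [ht.1], ht.2.le⟩] at h
    by_contra hc
    push Not at hc
    nlinarith [Real.exp_pos (L t).re]
  have hϑc : ContinuousOn (fun t => (L t).im) (Icc 0 1) := Complex.continuous_im.comp_continuousOn hL
  -- first half
  have hhalf : (L (1 / 2)).im ∈ Icc ((n₀ : ℝ) * (2 * Real.pi)) (n₀ * (2 * Real.pi) + Real.pi) :=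
    mem_Icc_of_sin_sub_pos (ϑ := fun t => (L t).im) (a := 0) (b := 1 / 2) (by norm_num)
      (hϑc.mono (Icc_subset_Icc_right (by norm_num))) him0 fun s hs => by
        show 0 < Real.sin ((L s).im - n₀ * (2 * Real.pi))
        rw [Real.sin_sub_int_mul_two_pi]
        exact hup' s hs
  have hn : n₁ = n₀ := by
    rw [himh] at hhalf
    obtain ⟨e₁, e₂⟩ := hhalf
    have f₁ : (n₀ : ℝ) * 2 ≤ 1 + n₁ * 2 := by nlinarith
    have f₂ : (1 : ℝ) + n₁ * 2 ≤ n₀ * 2 + 1 := by nlinarith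
    have g₁ : n₀ * 2 ≤ 1 + n₁ * 2 := by exact_mod_cast f₁
    have g₂ : 1 + n₁ * 2 ≤ n₀ * 2 + 1 := by exact_mod_cast f₂
    omega
  -- second half
  have hone : (L 1).im ∈ Icc (Real.pi + (n₀ : ℝ) * (2 * Real.pi))
      (Real.pi + n₀ * (2 * Real.pi) + Real.pi) :=
    mem_Icc_of_sin_sub_pos (ϑ := fun t => (L t).im) (a := 1 / 2) (b := 1) (by norm_num)
      (hϑc.mono (Icc_subset_Icc_left (by norm_num))) (by rw [← hn]; exact himh) fun s hs => by
        show 0 < Real.sin ((L s).im - (Real.pi + n₀ * (2 * Real.pi)))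
        rw [show (L s).im - (Real.pi + n₀ * (2 * Real.pi)) = (L s).im - Real.pi - n₀ * (2 * Real.pi)
          by ring, Real.sin_sub_int_mul_two_pi, Real.sin_sub_pi]
        exact neg_pos.2 (hdn' s hs)
  have hm1 : m = 1 := by
    rw [him1, him0] at hone
    obtain ⟨e₁, e₂⟩ := hone
    have f₁ : (1 : ℝ) ≤ m * 2 := by nlinarith
    have f₂ : (m : ℝ) * 2 ≤ 2 := by nlinarith
    have g₁ : 1 ≤ m * 2 := by exact_mod_cast f₁
    have g₂ : m * 2 ≤ 2 := by exact_mod_cast f₂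
    omega
  rw [hm, hm1]
  push_cast
  ring

/-! ### The logarithm symbol over a loop with that sign pattern is `ℓ(2πi)` -/

/-- **Winding number one on `𝔾ₘ`.**  Let `γ` be a `C¹` path on `𝔾ₘ`, closed, whose first coordinate `u` is real
`> 0` at `t = 0`, real `< 0` at `t = ½`, with `Im u > 0` on `(0, ½)` and `Im u < 0` on `(½, 1)`.  Then
`(𝔾ₘ, v du, γ) − (𝔾ₘ, v du, Λ_{1,1}) ∈ ⟨(R1)–(R5)⟩_ℚ̄` for the standard unit loop `Λ_{1,1}(t) = (e^{2πit}, e^{−2πit})`: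
the `C¹` logarithm of `u` (`exists_contDiff_exp_eq`) has increment `2πi` (`log_one_eq_log_zero_add_two_pi_I`), so
`γ` is (R5)-homotopic to `Λ_{u(0),1}` (`single_loop_eq_single_stdLoop`), which the (R4) base change `u ↦ u/u(0)`
carries to `Λ_{1,1}` (`rel_stdLoop_baseChange`). [cite: HuberWustholz2022, §3.3.1 (pp. 42–43), §13.1 (B) (p. 120)] -/
theorem span_logSym_halves (γ : CurvePath 𝔾m) {r₀ r₁ : ℝ} (hr₀ : 0 < r₀) (hr₁ : 0 < r₁)
    (h0 : γ.toFun 0 0 = (r₀ : ℂ)) (hh : γ.toFun (1 / 2) 0 = -(r₁ : ℂ))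
    (h1 : γ.toFun 1 0 = γ.toFun 0 0) (hup : ∀ t ∈ Ioo (0 : ℝ) (1 / 2), 0 < (γ.toFun t 0).im)
    (hdn : ∀ t ∈ Ioo (1 / 2 : ℝ) 1, (γ.toFun t 0).im < 0) (Λ₁ : CurvePath 𝔾m)
    (hΛ₁ : ∀ t, Λ₁.toFun t =
      ![1 * exp (((1 : ℤ) : ℂ) * (2 * π * I) * t), 1⁻¹ * exp (-(((1 : ℤ) : ℂ) * (2 * π * I) * t))]) :
    InSpanRel (Finsupp.single (logSym γ) (1 : ℂ) - Finsupp.single (logSym Λ₁) 1) := by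
  have hx : ContDiffOn ℝ 1 (fun t => γ.toFun t 0) (Icc 0 1) := contDiffOn_pi.1 γ.contDiffOn 0
  have hx0 : ∀ t ∈ Icc (0 : ℝ) 1, γ.toFun t 0 ≠ 0 := fun t ht =>
    left_ne_zero_of_mul_eq_one ((mem_points_mulGroup_iff _).1 (γ.mem_points t ht))
  obtain ⟨L, hLC, -, -, hLexp⟩ := exists_contDiff_exp_eq zero_lt_one hx hx0
  have hw : L 1 = L 0 + ((1 : ℤ) : ℂ) * (2 * π * I) := by
    rw [log_one_eq_log_zero_add_two_pi_I hLC.continuous.continuousOn hLexp hr₀ hr₁ h0 hh h1 hup hdn]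
    push_cast
    ring
  obtain ⟨Λ, ρ₁, ρ₂, ρ₃, hΛ, h₁, h₂, h₃, he⟩ :=
    single_loop_eq_single_stdLoop ![X 1, 0] hasAlgCoeffs_ydx γ L hLC hLexp 1 hw
  have hbc := rel_stdLoop_baseChange (γ.algebraic_zero 0) (hx0 0 ⟨le_rfl, zero_le_one⟩) 1 Λ Λ₁ hΛ hΛ₁
  obtain ⟨k, ρ, a, hρ, ha, hsum⟩ := span_add (span_sub (span_sub
    (span_smul (by exact_mod_cast isAlgebraic_nat (R := ℚ) (A := ℂ) 2 : IsAlgebraic ℚ (2 : ℂ))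
      (span_of_rel h₃)) (span_of_rel h₁)) (span_of_rel h₂)) (span_of_rel hbc)
  refine ⟨k, ρ, a, hρ, ha, ?_⟩
  rw [he, ← hsum, two_smul, two_smul]
  abel

/-- **`∫_γ v du = 2πi`** for such a loop (soundness of (R1)–(R5) and the period of the standard loop,
`period_ydx_stdLoop`). [cite: HuberWustholz2022, §10.1 (p. 96), Thm 13.3 (2) (p. 121)] -/
theorem period_logSym_halves (γ : CurvePath 𝔾m) {r₀ r₁ : ℝ} (hr₀ : 0 < r₀) (hr₁ : 0 < r₁)
    (h0 : γ.toFun 0 0 = (r₀ : ℂ)) (hh : γ.toFun (1 / 2) 0 = -(r₁ : ℂ))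
    (h1 : γ.toFun 1 0 = γ.toFun 0 0) (hup : ∀ t ∈ Ioo (0 : ℝ) (1 / 2), 0 < (γ.toFun t 0).im)
    (hdn : ∀ t ∈ Ioo (1 / 2 : ℝ) 1, (γ.toFun t 0).im < 0) (Λ₁ : CurvePath 𝔾m)
    (hΛ₁ : ∀ t, Λ₁.toFun t =
      ![1 * exp (((1 : ℤ) : ℂ) * (2 * π * I) * t), 1⁻¹ * exp (-(((1 : ℤ) : ℂ) * (2 * π * I) * t))]) :
    (logSym γ).period = 2 * π * I := by
  rw [period_eq_of_span (span_logSym_halves γ hr₀ hr₁ h0 hh h1 hup hdn Λ₁ hΛ₁)]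
  have h := period_ydx_stdLoop one_ne_zero 1 Λ₁ hΛ₁
  simpa using h

/-! ### The logarithm symbol over a closed positive real path is a relation -/

/-- **Winding number zero on `𝔾ₘ`.**  If the first coordinate of the `C¹` path `γ` on `𝔾ₘ` is real and positive
on `[0, 1]` with `r(0) = r(1)`, then `(𝔾ₘ, v du, γ) ∈ ⟨(R1)–(R5)⟩_ℚ̄`: it is `ℓ(log 1)` by `span_realPos_logSym`,
and `ℓ(log 1)` is the constant path (`span_logSym_one`). [cite: HuberWustholz2022, §3.3.1 (pp. 42–43)] -/
theorem span_logSym_realPos_closed (γ : CurvePath 𝔾m) {r : ℝ → ℝ}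
    (hr : ∀ t ∈ Icc (0 : ℝ) 1, γ.toFun t 0 = (r t : ℂ)) (hpos : ∀ t ∈ Icc (0 : ℝ) 1, 0 < r t)
    (hcl : r 0 = r 1) : InSpanRel (Finsupp.single (logSym γ) (1 : ℂ)) := by
  obtain ⟨E, hE⟩ := exists_realLogPath one_pos (by rw [Complex.ofReal_one]; exact isAlgebraic_one)
  have h₁ := span_realPos_logSym γ hr hpos (w := 1) (by rw [one_mul, hcl]) E hE
  have h₂ := span_logSym_one E hE
  obtain ⟨k, ρ, a, hρ, ha, hsum⟩ := span_add h₁ h₂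
  exact ⟨k, ρ, a, hρ, ha, by rw [← hsum]; abel⟩

/-- **`∫_γ v du = 0`** for such a path. [cite: HuberWustholz2022, Thm 13.3 (2) (p. 121)] -/
theorem period_logSym_realPos_closed (γ : CurvePath 𝔾m) {r : ℝ → ℝ}
    (hr : ∀ t ∈ Icc (0 : ℝ) 1, γ.toFun t 0 = (r t : ℂ)) (hpos : ∀ t ∈ Icc (0 : ℝ) 1, 0 < r t)
    (hcl : r 0 = r 1) : (logSym γ).period = 0 := by
  obtain ⟨k, ρ, a, hρ, ha, hc⟩ := span_logSym_realPos_closed γ hr hpos hcl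
  have h0 := evalCombination_eq_zero_of_isElementaryRelation ρ a hρ
  rw [← hc, evalCombination_single] at h0
  simpa using h0

end Summit.KontsevichZagierPeriods.KzOnePeriods.XiDerivation

end
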